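import Literature.Computability.AlgebraicComplexity.MalodGenericComputation
import Mathlib.Data.Nat.Choose.Multinomial
import HarnessLib

/-!
# VPBoundarySquare — W18 converse series, FILE 2a: the LEVEL EXPANSION of Malod's generic
computation (Bürgisser 2024, §4.2 (4.5)–(4.6), typed as ONE recursion on the top level)

P. Bürgisser, *Completeness classes in algebraic complexity theory* (arXiv:2406.06217, 2024), §4.2
(held text `paper:arxiv-2406.06217`, p0016 L41–L105). For Malod's generic computation
`G_{-n} = 1, G_{-n+q} = x_q (1 ≤ q ≤ n), G_m = (Σ_{i<m} a_{mi} G_i)(Σ_{j<m} b_{mj} G_j) (1 ≤ m ≤ n)`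
— the tree's `MalodGeneric.value k n q` at value index `q = n + m`, top `G_n =
MalodGeneric.genericComputation k n` (`MalodGenericComputation.lean`, (4.3) = `value_level`) — the
survey describes the coefficients combinatorially (p0016 L63–L102): expansion trees ↦ valid pairs
of multiplicity matrices `(A, B)`, each weighted by `∏_m multinom(A_{m•}) · multinom(B_{m•})`
((4.6)), «the key issue is to find a combinatorial description of the coefficients of the
monomials in `G_n`» (L63). That description is the `n`-fold unrolling of ONE identity: the
multinomial theorem (`Finset.sum_pow_eq_sum_piAntidiag`) applied to the TOP value against an
arbitrary DEMAND vector `t : ℕ → ℕ` (how many copies of each value remain to be expanded),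
`∏_{q ≤ n+m+1} G_q^{t_q}
   = Σ_{α, β ⊢ t_{n+m+1}} multinom(α) · multinom(β) · a_{m+1}^α b_{m+1}^β · ∏_{q ≤ n+m} G_q^{t_q+α_q+β_q}`
(`α, β` over `Finset.piAntidiag (range (n+m+1)) (t (n+m+1))`; `prod_value_pow_succ`), the demand
handed down being `t + α + β` (its total grows by the top demand, `sum_demand_succ` — the
«exponential bitsize» of L104–L105, i.e. polynomially many BITS).

* §1 DATA (2 defs, D-0009): `levelMon k n m α β = a_{m+1}^α b_{m+1}^β` and the closed recursion
  `levelExpand k n : ℕ → (ℕ → ℕ) → MvPolynomial (Var n) k` (`E_0(t) = ∏_{q ≤ n} (input q)^{t_q}`,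
  `E_{m+1}(t) = Σ_{α,β} multinom(α) multinom(β) · levelMon m α β · E_m(t + α + β)`).
* §2 one level: `value_succ` ((4.3) in `Finset` dress), `linForm_pow_eq_sum_piAntidiag`,
  `prod_value_pow_succ`, `sum_demand_succ`.
* §3 **`prod_value_pow_eq_levelExpand`**: `∏_{q ≤ n+m} G_q^{t_q} = E_m(t)` for every `m` and every
  demand `t`; **`genericComputation_eq_levelExpand`**: `G_n = E_n(δ_{2n})`; the bottom
  `levelExpand_zero` (the input monomial `x^d`, L73–L76) and the one-step unfolding
  `levelExpand_succ` (the interface the converse recurses on).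

Honest framing: a kernel-checked expansion formula for a published universal object (the survey
credits the generic computation to [buer:00-3] and the coefficient description to Malod 2007); it
serves the converse `binomTable ∈ VNP^ℂ ⟹ B_nb` of the lineage's W18 series (the multinomial
weights are where binomial coefficients of binary arguments enter; FILE 4 builds its VNP gadget
by the same recursion on `m` with `t, α, β` in binary) and proves nothing about `VP ≠ VNP`, about
`B_nb = VNPnbPFamSubsetVNP ℂ`, or about `binomTable ∈ VNP^ℂ`. IDENTITIES ONLY — nothing about
`VP / VNP / VPnb / VNPnb / B_nb` is proved; the completeness arrow (`binomTable ∈ VNP^ℂ ⟹ NF_ℂ ⟹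
B_nb`) is FILES 3–4 of the series, UNBUILT; Poizat 2014, *Malod and the Pascaline*
(doi:10.1007/978-3-319-05446-9_8, not held: acq-15003) may already contain it. No class-level
statement and no named fact occurs in this file.

## References

* [Burgisser2024Completeness] P. Bürgisser, arXiv:2406.06217 (2024), §4.2 (4.3)–(4.6) (p0016
  L41–L105).
* [Burgisser2000] P. Bürgisser, *Completeness and Reduction in Algebraic Complexity Theory*,
  Springer (2000), Ch. 5 (the generic computation, cited as [buer:00-3] on p0016 L52).
-/

set_option linter.dupNamespace false

noncomputable section

namespace Summit.ValiantsHypothesis.ValiantsHypothesis.Theorems.VPBoundarySquareNbLevelExpansion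

open MvPolynomial Finset Literature.Computability.AlgebraicComplexity
open Literature.Computability.AlgebraicComplexity.MalodGeneric

variable (k : Type*) [CommRing k] (n : ℕ)

/-! ## §1 Data: the level monomial and the level expansion -/

/-- The coefficient monomial `a_{m+1}^α b_{m+1}^β = ∏_{q ≤ n+m} a_{m+1,q}^{α q} b_{m+1,q}^{β q}` of one
choice `(α, β)` at level `m + 1`. [cite: Burgisser2024Completeness, §4.2 (p0016 L78–L82)] -/
def levelMon (m : ℕ) (α β : ℕ → ℕ) : MvPolynomial (Var n) k :=
  ∏ q ∈ range (n + m + 1), (coef k n (m + 1) q false ^ α q * coef k n (m + 1) q true ^ β q)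

/-- **The level expansion** `E_m(t)`: `E_0(t) = ∏_{q ≤ n} G_q^{t_q}` (inputs only), and
`E_{m+1}(t) = Σ_{α, β ∈ piAntidiag (range (n+m+1)) (t (n+m+1))} multinom(α) multinom(β) ·
a_{m+1}^α b_{m+1}^β · E_m(t + α + β)` — Bürgisser's (4.5)–(4.6) as a recursion on the top level.
[cite: Burgisser2024Completeness, §4.2 (4.5)–(4.6) (p0016 L63–L102)] -/
def levelExpand : ℕ → (ℕ → ℕ) → MvPolynomial (Var n) k
  | 0, t => ∏ q ∈ range (n + 1), input k n q ^ t q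
  | m + 1, t =>
      ∑ α ∈ (range (n + m + 1)).piAntidiag (t (n + m + 1)),
        ∑ β ∈ (range (n + m + 1)).piAntidiag (t (n + m + 1)),
          ((Nat.multinomial (range (n + m + 1)) α * Nat.multinomial (range (n + m + 1)) β : ℕ) :
              MvPolynomial (Var n) k) * (levelMon k n m α β * levelExpand m (t + α + β))

/-! ## §2 One level: the defining equation in `Finset` form and the multinomial theorem -/

/-- (4.3) at value index `n + m + 1` (level `m + 1`), `Finset` form of the tree's `value_level`.
[cite: Burgisser2024Completeness, §4.2 (4.3) (p0016 L46–L50)] -/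
theorem value_succ (m : ℕ) :
    value k n (n + m + 1) =
      (∑ q ∈ range (n + m + 1), coef k n (m + 1) q false * value k n q) *
        ∑ q ∈ range (n + m + 1), coef k n (m + 1) q true * value k n q := by
  -- `List.range` sums are `Finset.range` sums (kept local: the tree's landed copy of this
  -- one-liner lives in an unrelated representation-theory module).
  have hl : ∀ (q : ℕ) (f : ℕ → MvPolynomial (Var n) k),
      ((List.range q).map f).sum = ∑ i ∈ range q, f i := by
    intro q f
    induction q with
    | zero => simp
    | succ q ih =>
      rw [List.range_succ, List.map_append, List.sum_append, List.map_singleton,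
        List.sum_singleton, ih, Finset.sum_range_succ]
  have h := value_level k n (show n < n + m + 1 by omega)
  rw [show n + m + 1 - n = m + 1 by omega, hl, hl] at h
  exact h

/-- The multinomial theorem for one linear form of level `m`: `(Σ_{q<Q} a_{mq} G_q)^T =
Σ_{α ⊢ T} multinom(α) a_m^α ∏ G_q^{α_q}`. [cite: Burgisser2024Completeness, §4.2 (p0016 L64–L68, L93–L99)] -/
theorem linForm_pow_eq_sum_piAntidiag (m Q T : ℕ) (s : Bool) :
    (∑ q ∈ range Q, coef k n m q s * value k n q) ^ T =
      ∑ α ∈ (range Q).piAntidiag T, (Nat.multinomial (range Q) α : MvPolynomial (Var n) k) *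
        ((∏ q ∈ range Q, coef k n m q s ^ α q) * ∏ q ∈ range Q, value k n q ^ α q) := by
  rw [Finset.sum_pow_eq_sum_piAntidiag]
  refine Finset.sum_congr rfl fun α _ => ?_
  rw [← Finset.prod_mul_distrib]
  congr 1
  exact Finset.prod_congr rfl fun q _ => mul_pow _ _ _

/-- Eliminating the top value: `∏_{q ≤ n+m+1} G_q^{t_q} = Σ_{α, β ⊢ t_{n+m+1}} multinom(α)
multinom(β) a_{m+1}^α b_{m+1}^β ∏_{q ≤ n+m} G_q^{(t+α+β)_q}`.
[cite: Burgisser2024Completeness, §4.2 (4.5) (p0016 L64–L91)] -/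
theorem prod_value_pow_succ (m : ℕ) (t : ℕ → ℕ) :
    ∏ q ∈ range (n + m + 2), value k n q ^ t q =
      ∑ α ∈ (range (n + m + 1)).piAntidiag (t (n + m + 1)),
        ∑ β ∈ (range (n + m + 1)).piAntidiag (t (n + m + 1)),
          ((Nat.multinomial (range (n + m + 1)) α * Nat.multinomial (range (n + m + 1)) β : ℕ) :
              MvPolynomial (Var n) k) *
            (levelMon k n m α β * ∏ q ∈ range (n + m + 1), value k n q ^ (t + α + β) q) := by
  rw [show n + m + 2 = n + m + 1 + 1 from rfl, Finset.prod_range_succ, value_succ, mul_pow,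
    linForm_pow_eq_sum_piAntidiag, linForm_pow_eq_sum_piAntidiag, Finset.sum_mul_sum,
    Finset.mul_sum]
  refine Finset.sum_congr rfl fun α _ => ?_
  rw [Finset.mul_sum]
  refine Finset.sum_congr rfl fun β _ => ?_
  have hV : ∏ q ∈ range (n + m + 1), value k n q ^ (t + α + β) q =
      (∏ q ∈ range (n + m + 1), value k n q ^ t q) * (∏ q ∈ range (n + m + 1), value k n q ^ α q) *
        ∏ q ∈ range (n + m + 1), value k n q ^ β q := by
    rw [← Finset.prod_mul_distrib, ← Finset.prod_mul_distrib]
    exact Finset.prod_congr rfl fun q _ => by rw [Pi.add_apply, Pi.add_apply, pow_add, pow_add]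
  rw [hV, levelMon, Finset.prod_mul_distrib, Nat.cast_mul]
  ring

/-- Demand bookkeeping of one level: the total demand handed down is the old total plus the top
demand (so it at most doubles per level — the source of the polynomial bit-size of `(A, B)`).
[cite: Burgisser2024Completeness, §4.2 (p0016 L104–L105)] -/
theorem sum_demand_succ (m : ℕ) (t α β : ℕ → ℕ)
    (hα : α ∈ (range (n + m + 1)).piAntidiag (t (n + m + 1)))
    (hβ : β ∈ (range (n + m + 1)).piAntidiag (t (n + m + 1))) :
    ∑ q ∈ range (n + m + 1), (t + α + β) q = ∑ q ∈ range (n + m + 2), t q + t (n + m + 1) := by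
  rw [Finset.mem_piAntidiag] at hα hβ
  simp only [Pi.add_apply, Finset.sum_add_distrib]
  rw [hα.1, hβ.1, show n + m + 2 = n + m + 1 + 1 from rfl]
  simp only [Finset.sum_range_succ]

/-! ## §3 The expansion theorem -/

/-- **Level expansion theorem**: for every number `m` of levels and every demand `t`,
`∏_{q ≤ n+m} G_q^{t_q} = E_m(t)` (no `m ≤ n` needed: beyond level `n` both sides wrap the
coefficient indices identically, as `value_level` does).
[cite: Burgisser2024Completeness, §4.2 (4.5)–(4.6) (p0016 L63–L102)] -/
theorem prod_value_pow_eq_levelExpand (m : ℕ) (t : ℕ → ℕ) :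
    ∏ q ∈ range (n + m + 1), value k n q ^ t q = levelExpand k n m t := by
  induction m generalizing t with
  | zero =>
    simp only [Nat.add_zero, levelExpand]
    exact Finset.prod_congr rfl fun q hq => by
      rw [value_input k n (Nat.lt_succ_iff.mp (Finset.mem_range.mp hq))]
  | succ m ih =>
    rw [show n + (m + 1) + 1 = n + m + 2 by omega, prod_value_pow_succ]
    simp only [levelExpand]
    refine Finset.sum_congr rfl fun α _ => Finset.sum_congr rfl fun β _ => ?_
    rw [ih]

/-- **Malod's generic computation is its own level expansion**: `G_n = E_n(δ_{2n})`.
[cite: Burgisser2024Completeness, §4.2 (4.5)–(4.6) (p0016 L63–L102)] -/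
theorem genericComputation_eq_levelExpand :
    genericComputation k n = levelExpand k n n (Pi.single (2 * n) 1) := by
  have h1 : ∏ q ∈ range (2 * n), value k n q ^ (Pi.single (2 * n) 1 : ℕ → ℕ) q = 1 :=
    Finset.prod_eq_one fun q hq => by
      rw [Pi.single_eq_of_ne (Finset.mem_range.mp hq).ne, pow_zero]
  rw [← prod_value_pow_eq_levelExpand, genericComputation, show n + n + 1 = 2 * n + 1 by omega,
    Finset.prod_range_succ, h1, one_mul, Pi.single_eq_same, pow_one]

/-- The bottom of the recursion is the input monomial `x_1^{t_1} ⋯ x_n^{t_n}` (`G_{-n} = 1` absorbs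
`t_0`). [cite: Burgisser2024Completeness, §4.2 (p0016 L73–L76)] -/
theorem levelExpand_zero (t : ℕ → ℕ) :
    levelExpand k n 0 t = ∏ q ∈ range n, X (Sum.inl (Fin.ofNat (n + 1) (q + 1))) ^ t (q + 1) := by
  simp only [levelExpand]
  rw [Finset.prod_range_succ']
  simp [input]

/-- One level of the recursion as a rewrite rule: `E_{m+1}(t) = Σ_{α,β ⊢ t_{n+m+1}} multinom(α)
multinom(β) · a_{m+1}^α b_{m+1}^β · E_m(t + α + β)` (the interface the converse recurses on).
[cite: Burgisser2024Completeness, §4.2 (4.5)–(4.6) (p0016 L63–L102)] -/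
theorem levelExpand_succ (m : ℕ) (t : ℕ → ℕ) :
    levelExpand k n (m + 1) t =
      ∑ α ∈ (range (n + m + 1)).piAntidiag (t (n + m + 1)),
        ∑ β ∈ (range (n + m + 1)).piAntidiag (t (n + m + 1)),
          ((Nat.multinomial (range (n + m + 1)) α * Nat.multinomial (range (n + m + 1)) β : ℕ) :
              MvPolynomial (Var n) k) * (levelMon k n m α β * levelExpand k n m (t + α + β)) := by
  simp only [levelExpand]

end Summit.ValiantsHypothesis.ValiantsHypothesis.Theorems.VPBoundarySquareNbLevelExpansion
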